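import Literature.NumberTheory.LFunctions.Zhang2022.Section7Eq75Discharge
import Literature.NumberTheory.LFunctions.Zhang2022.RepairGapProp21ScaleLaw
import HarnessLib

/-!
# Zhang (2022), rescue GAP/REQSIDE (D-0124 (4)–(5)): the SCALE LAW of (7.5) — the Cauchy chain of §7
# goes through with Proposition 2.1 at ANY exponent `e ≥ 718`, hence (7.5) holds under (A) at exponent
# `E ≥ 2001`; the located budget's requirement `e_req = 717` and its S0 corner as theorems (sufficiency)

Topic `Literature/NumberTheory/LFunctions/Zhang2022` (Landau–Siegel audit tree; verdict-neutral).
Y. Zhang, *Discrete mean estimates and the Landau–Siegel zero*, arXiv:2211.02515v1 (2022)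
[Zhang2022LandauSiegel] — **an unrefereed manuscript under adjudication; nothing in this file asserts or
denies its Theorems 1–2, and nothing here is a claim about Landau–Siegel zeros. The programme SEARCHES and
TYPES; no claim about Landau–Siegel zeros, Theorems 1–2 of arXiv:2211.02515 or a repaired Margin232 until a
kernel theorem says so.**

(7.5) (§7 p. 35: "`∑_{ψ∈Ψ₂} |∑_{m<P²}(κ∗a₁)(m)ψ(m)m^{−s}| |A(𝐚₂;1−s,ψ̄)| = o(𝔓)` … by Cauchy's inequality
… `≪ (P²∑τ₅²/m)^{1/2}(P²∑τ₂²/m)^{1/4}(∑_{Ψ₂}1)^{1/4}`. This yields (7.5) by Proposition 2.1 and (2.9)") is the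
tree theorem `Section7Eq75.eq75_holds` (`Section7Eq75Discharge`), whose exponent count is the opaque-real lemma
`Section7Eq75.le_eps_mul_of_bounds` with the literal `739` of Proposition 2.1 (fourth powers:
`𝓛^{450+36−739} = 𝓛^{−253}` against `𝓛^{−231}`). The rescue's exponent budget (kit LP-3 j271838; kernel twin
`Repair.Gap.ExpTuple`, `RepairGapExponentBudget`) reads this step as the REQUIREMENT «`e ≥ e_req = 2·25·x_P + 4·x_P
+ 3(w + x_P) = 717`» on Proposition 2.1's exponent (desk reading `ExpTuple.eReq`; «at the boundary `e = e_req` the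
manuscript's `o(𝔓)` degrades to `O(𝔓)`; the desk's `E_min` is an infimum»). This file DERIVES the requirement from
the tree's count with the exponent free, and composes it with the Part-I scale law
`Repair.Gap.prop21_scale_of_assumptionAWith` (`E = k + 1283`):

* `le_eps_mul_of_bounds_scale` — the count of `le_eps_mul_of_bounds` with `#Ψ₂ ≤ C₂₁𝔓𝓛^{−e}` for ANY natural
  `e ≥ 718` (fourth powers `𝓛^{486−e} ≤ 𝓛^{−232}` against `𝓛^{−231}`: one power of `𝓛` absorbs `8K₁/ε⁴`); at
  `e = 717` the same algebra leaves `8K₁ ≤ ε⁴`, i.e. `O(𝔓)` not `o(𝔓)` — the desk's boundary remark;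
* `eq75_scale_of_prop21_rate` — (7.5) (`Section7aStatements.Eq75`'s body, with the guard `AssumptionAWith E`)
  from ANY eventual bound `#Ψ₂ ≤ C𝔓𝓛^{−e}` under that guard, `e ≥ 718`, via the tree's discharged Cauchy lines
  `step7u019a_holds` / `step7u019b_holds` and (2.9) `frakP_bounds`;
* `eq75_scale_of_assumptionAWith` — hence (7.5) under `Repair.Bed.AssumptionAWith E` for every real `E ≥ 2001`
  (`= 718 + 1283`, `prop21_scale_of_assumptionAWith 718`).

READING (GAP G-31 / REQSIDE (5), as-typed): along the tree's routes the whole located S0 line is now kernel on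
the SUFFICIENCY side — (A) at exponent `E ≥ 2001` gives (7.5) (the desk's infimum `2000` is the excluded
boundary `e = 717`; the printed `2022` has slack `21` here); nothing is claimed about necessity, about the
rest of Prop. 7.1 (`Skeleton.Ded71`, whose other inputs are (A)-free or main-term doors at `E ≥ 15`), or about
(A). Theorems only; no definition, no named fact.

## References

* Y. Zhang, arXiv:2211.02515v1 (2022), §7 (7.5) p. 35; §2 Prop. 2.1, (2.9); §3 Lemma 3.3.
  [cite: Zhang2022LandauSiegel, §7 (7.5) p.35]
-/

noncomputable section

open Complex Real

namespace Literature.NumberTheory.LFunctions.Zhang2022.Repair.Gap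

open Finset MeanSquareMajorant
open Literature.NumberTheory.LFunctions.Zhang2022 (frakP frakP_bounds)
open Literature.NumberTheory.LFunctions.Zhang2022.Skeleton
open Literature.NumberTheory.LFunctions.Zhang2022.Section7aStatements (kconvHead PsiAll)
open Literature.NumberTheory.LFunctions.Zhang2022.Section7Eq75 (step7u019a_holds step7u019b_holds
  sum_tau_sq_div_Ico_le exists_nat_le_ell)
open Literature.NumberTheory.LFunctions.Zhang2022.Repair.Bed (AssumptionAWith)

/-! ## The exponent count with Proposition 2.1's exponent free -/

/-- **The exponent count of (7.5) with Proposition 2.1 at exponent `e ≥ 718`, on opaque reals.** If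
`X ≤ C (P²S₅)^{1/2}(P²S₂)^{1/4}n₂^{1/4}` with `S₅ ≤ M₅(2L⁹)²⁵`, `S₂ ≤ M₂(2L⁹)⁴`, `n₂ ≤ C₂₁ F L^{−e}` and
`|F − P²L⁻⁷⁷| ≤ 3L⁻⁶⁸·P²L⁻⁷⁷` ((2.9)), then `X ≤ εF` as soon as `L ≥ 6` and `L ≥ 8K₁/ε⁴`,
`K₁ = |C|⁴M₅²M₂|C₂₁|2⁵⁴` (fourth powers: `L^{450+36−e} ≤ L^{−232}` against `L^{−231}`). The tree's
`Section7Eq75.le_eps_mul_of_bounds` is `e = 739`. [cite: Zhang2022LandauSiegel, §7 (7.5) p.35, tex L1903–L1910] -/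
theorem le_eps_mul_of_bounds_scale (e : ℕ) (he : 718 ≤ e) {X C C₂₁ M₅ M₂ P S5 S2 n2 F L ε : ℝ}
    (hε : 0 < ε) (hP : 0 < P) (hS5 : 0 ≤ S5) (hS2 : 0 ≤ S2) (hn2 : 0 ≤ n2) (hM2 : 0 ≤ M₂)
    (hX : X ≤ C * (P ^ 2 * S5) ^ (1 / 2 : ℝ) * (P ^ 2 * S2) ^ (1 / 4 : ℝ) * n2 ^ (1 / 4 : ℝ))
    (hS5le : S5 ≤ M₅ * (2 * L ^ 9) ^ (5 ^ 2)) (hS2le : S2 ≤ M₂ * (2 * L ^ 9) ^ (2 ^ 2))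
    (hn2le : n2 ≤ C₂₁ * F * (L ^ e)⁻¹)
    (hfr : |F - P ^ 2 * (L ^ 77)⁻¹| ≤ 3 * (L ^ 68)⁻¹ * (P ^ 2 * (L ^ 77)⁻¹))
    (hL6 : 6 ≤ L) (hLK : 8 * (|C| ^ 4 * M₅ ^ 2 * M₂ * |C₂₁| * 2 ^ 54) / ε ^ 4 ≤ L) :
    X ≤ ε * F := by
  have hL1 : 1 ≤ L := by linarith
  have hL0 : 0 < L := by linarith
  have hK₁ : 0 ≤ |C| ^ 4 * M₅ ^ 2 * M₂ * |C₂₁| * 2 ^ 54 := by positivity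
  -- (2.9): `Q/2 ≤ F`, `Q = P²L⁻⁷⁷`
  have hQ : 0 ≤ P ^ 2 * (L ^ 77)⁻¹ := by positivity
  have h3L : 3 * (L ^ 68)⁻¹ ≤ 1 / 2 := by
    have h68 : (6 : ℝ) ≤ L ^ 68 := le_trans hL6 (le_self_pow₀ hL1 (by norm_num))
    rw [show 3 * (L ^ 68)⁻¹ = 3 / L ^ 68 from by ring,
      div_le_div_iff₀ (by positivity) (by norm_num)]
    linarith
  have hfr' : |F - P ^ 2 * (L ^ 77)⁻¹| ≤ 1 / 2 * (P ^ 2 * (L ^ 77)⁻¹) :=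
    hfr.trans (mul_le_mul_of_nonneg_right h3L hQ)
  have hFlo : P ^ 2 * (L ^ 77)⁻¹ / 2 ≤ F := by
    have := (abs_sub_le_iff.1 hfr').2; linarith
  have hF : 0 ≤ F := le_trans (by positivity) hFlo
  have hn2le' : n2 ≤ |C₂₁| * F * (L ^ e)⁻¹ :=
    hn2le.trans (mul_le_mul_of_nonneg_right
      (mul_le_mul_of_nonneg_right (le_abs_self _) hF) (by positivity))
  -- `L^{486} L^{−e} ≤ L^{−232}` (`e ≥ 718 = 486 + 232`)
  have hpow : L ^ 486 * (L ^ e)⁻¹ ≤ (L ^ 232)⁻¹ := by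
    have h718 : L ^ 486 * L ^ 232 ≤ L ^ e := by
      rw [← pow_add]; exact pow_le_pow_right₀ hL1 (by omega)
    rw [mul_inv_le_iff₀ (by positivity), le_inv_mul_iff₀ (by positivity)]
    linarith [h718]
  -- `X ≤ R`, `R = |C|·(…)`
  have hX5 : 0 ≤ P ^ 2 * S5 := by positivity
  have hX2 : 0 ≤ P ^ 2 * S2 := by positivity
  have hprod : 0 ≤ (P ^ 2 * S5) ^ (1 / 2 : ℝ) * (P ^ 2 * S2) ^ (1 / 4 : ℝ) * n2 ^ (1 / 4 : ℝ) := by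
    positivity
  have hXR : X ≤ |C| * ((P ^ 2 * S5) ^ (1 / 2 : ℝ) * (P ^ 2 * S2) ^ (1 / 4 : ℝ) * n2 ^ (1 / 4 : ℝ)) := by
    refine hX.trans ?_
    have hC := mul_le_mul_of_nonneg_right (le_abs_self C) hprod
    calc C * (P ^ 2 * S5) ^ (1 / 2 : ℝ) * (P ^ 2 * S2) ^ (1 / 4 : ℝ) * n2 ^ (1 / 4 : ℝ)
        = C * ((P ^ 2 * S5) ^ (1 / 2 : ℝ) * (P ^ 2 * S2) ^ (1 / 4 : ℝ) * n2 ^ (1 / 4 : ℝ)) := by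
          ring
      _ ≤ _ := hC
  have hR0 : 0 ≤ |C| * ((P ^ 2 * S5) ^ (1 / 2 : ℝ) * (P ^ 2 * S2) ^ (1 / 4 : ℝ) * n2 ^ (1 / 4 : ℝ)) :=
    mul_nonneg (abs_nonneg C) hprod
  -- fourth powers
  have ha4 : ((P ^ 2 * S5) ^ (1 / 2 : ℝ)) ^ 4 = (P ^ 2 * S5) ^ 2 := by
    rw [← Real.rpow_natCast, ← Real.rpow_mul hX5,
      show ((1 : ℝ) / 2 * ((4 : ℕ) : ℝ)) = 2 by norm_num, Real.rpow_two]
  have hb4 : ((P ^ 2 * S2) ^ (1 / 4 : ℝ)) ^ 4 = P ^ 2 * S2 := by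
    rw [← Real.rpow_natCast, ← Real.rpow_mul hX2,
      show ((1 : ℝ) / 4 * ((4 : ℕ) : ℝ)) = 1 by norm_num, Real.rpow_one]
  have hc4 : (n2 ^ (1 / 4 : ℝ)) ^ 4 = n2 := by
    rw [← Real.rpow_natCast, ← Real.rpow_mul hn2,
      show ((1 : ℝ) / 4 * ((4 : ℕ) : ℝ)) = 1 by norm_num, Real.rpow_one]
  have hR4 : (|C| * ((P ^ 2 * S5) ^ (1 / 2 : ℝ) * (P ^ 2 * S2) ^ (1 / 4 : ℝ) * n2 ^ (1 / 4 : ℝ))) ^ 4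
      = |C| ^ 4 * (P ^ 2 * S5) ^ 2 * (P ^ 2 * S2) * n2 := by
    calc (|C| * ((P ^ 2 * S5) ^ (1 / 2 : ℝ) * (P ^ 2 * S2) ^ (1 / 4 : ℝ) * n2 ^ (1 / 4 : ℝ))) ^ 4
        = |C| ^ 4 * ((P ^ 2 * S5) ^ (1 / 2 : ℝ)) ^ 4 * ((P ^ 2 * S2) ^ (1 / 4 : ℝ)) ^ 4 *
            (n2 ^ (1 / 4 : ℝ)) ^ 4 := by ring
      _ = |C| ^ 4 * (P ^ 2 * S5) ^ 2 * (P ^ 2 * S2) * n2 := by rw [ha4, hb4, hc4]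
  have hR4le : |C| ^ 4 * (P ^ 2 * S5) ^ 2 * (P ^ 2 * S2) * n2 ≤
      (|C| ^ 4 * M₅ ^ 2 * M₂ * |C₂₁| * 2 ^ 54) * (P ^ 6 * F) * (L ^ 232)⁻¹ := by
    have h5 : (P ^ 2 * S5) ^ 2 ≤ (P ^ 2 * (M₅ * (2 * L ^ 9) ^ (5 ^ 2))) ^ 2 :=
      pow_le_pow_left₀ hX5 (mul_le_mul_of_nonneg_left hS5le (sq_nonneg _)) 2
    have h2 : P ^ 2 * S2 ≤ P ^ 2 * (M₂ * (2 * L ^ 9) ^ (2 ^ 2)) :=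
      mul_le_mul_of_nonneg_left hS2le (sq_nonneg _)
    have hPF : 0 ≤ (|C| ^ 4 * M₅ ^ 2 * M₂ * |C₂₁| * 2 ^ 54) * (P ^ 6 * F) := by positivity
    calc |C| ^ 4 * (P ^ 2 * S5) ^ 2 * (P ^ 2 * S2) * n2
        ≤ |C| ^ 4 * (P ^ 2 * (M₅ * (2 * L ^ 9) ^ (5 ^ 2))) ^ 2 *
            (P ^ 2 * (M₂ * (2 * L ^ 9) ^ (2 ^ 2))) * (|C₂₁| * F * (L ^ e)⁻¹) := by
          gcongr
      _ = (|C| ^ 4 * M₅ ^ 2 * M₂ * |C₂₁| * 2 ^ 54) * (P ^ 6 * F) * (L ^ 486 * (L ^ e)⁻¹) := by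
          ring
      _ ≤ (|C| ^ 4 * M₅ ^ 2 * M₂ * |C₂₁| * 2 ^ 54) * (P ^ 6 * F) * (L ^ 232)⁻¹ :=
          mul_le_mul_of_nonneg_left hpow hPF
  -- `(εF)⁴ ≥ ε⁴ F (Q/2)³`
  have hε4 : ε ^ 4 * (P ^ 6 * F) / (8 * L ^ 231) ≤ (ε * F) ^ 4 := by
    have h1 : (P ^ 2 * (L ^ 77)⁻¹ / 2) ^ 3 ≤ F ^ 3 := pow_le_pow_left₀ (by positivity) hFlo 3
    have eq1 : ε ^ 4 * (P ^ 6 * F) / (8 * L ^ 231) = ε ^ 4 * F * (P ^ 2 * (L ^ 77)⁻¹ / 2) ^ 3 := by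
      field_simp
      ring
    rw [eq1]
    calc ε ^ 4 * F * (P ^ 2 * (L ^ 77)⁻¹ / 2) ^ 3 ≤ ε ^ 4 * F * F ^ 3 :=
          mul_le_mul_of_nonneg_left h1 (by positivity)
      _ = (ε * F) ^ 4 := by ring
  -- the comparison `K₁ L⁻²³² ≤ ε⁴ L⁻²³¹/8` (one power of `L` against `8K₁/ε⁴ ≤ L`)
  have hkey : (|C| ^ 4 * M₅ ^ 2 * M₂ * |C₂₁| * 2 ^ 54) * (P ^ 6 * F) * (L ^ 232)⁻¹ ≤
      ε ^ 4 * (P ^ 6 * F) / (8 * L ^ 231) := by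
    have hcmp : (|C| ^ 4 * M₅ ^ 2 * M₂ * |C₂₁| * 2 ^ 54) * (L ^ 232)⁻¹ ≤ ε ^ 4 / (8 * L ^ 231) := by
      rw [← div_eq_mul_inv, div_le_div_iff₀ (by positivity) (by positivity)]
      have h22 : 8 * (|C| ^ 4 * M₅ ^ 2 * M₂ * |C₂₁| * 2 ^ 54) ≤ ε ^ 4 * L := by
        have h := (div_le_iff₀ (by positivity : (0 : ℝ) < ε ^ 4)).1 hLK
        linarith
      calc (|C| ^ 4 * M₅ ^ 2 * M₂ * |C₂₁| * 2 ^ 54) * (8 * L ^ 231)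
          = 8 * (|C| ^ 4 * M₅ ^ 2 * M₂ * |C₂₁| * 2 ^ 54) * L ^ 231 := by ring
        _ ≤ ε ^ 4 * L * L ^ 231 := mul_le_mul_of_nonneg_right h22 (by positivity)
        _ = ε ^ 4 * L ^ 232 := by rw [mul_assoc, ← pow_succ']
    have hPF : 0 ≤ P ^ 6 * F := by positivity
    calc (|C| ^ 4 * M₅ ^ 2 * M₂ * |C₂₁| * 2 ^ 54) * (P ^ 6 * F) * (L ^ 232)⁻¹
        = (|C| ^ 4 * M₅ ^ 2 * M₂ * |C₂₁| * 2 ^ 54) * (L ^ 232)⁻¹ * (P ^ 6 * F) := by ring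
      _ ≤ ε ^ 4 / (8 * L ^ 231) * (P ^ 6 * F) := mul_le_mul_of_nonneg_right hcmp hPF
      _ = ε ^ 4 * (P ^ 6 * F) / (8 * L ^ 231) := by ring
  have h4 : (|C| * ((P ^ 2 * S5) ^ (1 / 2 : ℝ) * (P ^ 2 * S2) ^ (1 / 4 : ℝ) * n2 ^ (1 / 4 : ℝ))) ^ 4
      ≤ (ε * F) ^ 4 := by
    rw [hR4]
    exact hR4le.trans (hkey.trans hε4)
  have hεF : 0 ≤ ε * F := mul_nonneg hε.le hF
  exact hXR.trans ((pow_le_pow_iff_left₀ hR0 hεF four_ne_zero).1 h4)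

/-! ## (7.5) from Proposition 2.1 at any exponent `e ≥ 718`, and from `AssumptionAWith E`, `E ≥ 2001` -/

/-- **(7.5) from an eventual count `#Ψ₂ ≤ C𝔓𝓛^{−e}` at any exponent `e ≥ 718`** (the body of
`Section7aStatements.Eq75 c′` with the guard `AssumptionAWith E` in place of the printed (A)): if, for all
large `D` and every real primitive `χ`, `AssumptionAWith E D χ → #Ψ₂ ≤ C·𝔓·(𝓛^e)⁻¹`, then for every `B`,
`ε > 0`, all large `D`, `AssumptionAWith E D χ`, all `𝐚₁, 𝐚₂` satisfying (7.2) with `B` and all `s` with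
`Re s = 1/2`: `∑_{ψ∈Ψ₂} |∑_{m<P²}(κ∗a₁)(m)ψ(m)m^{−s}|·|A(𝐚₂;1−s,ψ̄)| ≤ ε𝔓`. The tree's `dedEq75_holds`
verbatim (Cauchy lines `step7u019a_holds`, `step7u019b_holds`, divisor counts `sum_tau_sq_div_Ico_le`, (2.9)
`frakP_bounds`) over `le_eps_mul_of_bounds_scale e`. [cite: Zhang2022LandauSiegel, §7 (7.5) p.35, tex L1900–L1910] -/
theorem eq75_scale_of_prop21_rate (c' : ℝ) (e : ℕ) (he : 718 ≤ e) {E : ℝ}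
    (h21 : ∃ C : ℝ, ForAllLarge fun D _ χ => AssumptionAWith E D χ →
      ((PsiTwo χ).ncard : ℝ) ≤ C * frakP D * (ell D ^ e)⁻¹) :
    ∀ B : ℝ, ∀ ε : ℝ, 0 < ε → ForAllLarge fun D _ χ => AssumptionAWith E D χ →
      ∀ a₁ a₂ : ℕ → ℂ, Adm72 D B a₁ → Adm72 D B a₂ →
        ∀ s : ℂ, s.re = 1 / 2 →
          ∑ x ∈ finsetOf (PsiTwo χ),
              ‖kconvHead c' x a₁ s‖ * ‖ApolyBar x a₂ (1 - s)‖ ≤ ε * frakP D := by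
  intro B ε hε
  have ha := step7u019a_holds c'
  obtain ⟨C, D₁, hD₁⟩ := step7u019b_holds c' B
  obtain ⟨C₂₁, D₂, hD₂⟩ := h21
  obtain ⟨D₃, hD₃⟩ := frakP_bounds
  obtain ⟨D₄, hD₄⟩ := exists_nat_le_ell
    (max (8 * (|C| ^ 4 * majorantConst (5 ^ 2) (2 * 5) ^ 2 * majorantConst (2 ^ 2) (2 * 2) *
      |C₂₁| * 2 ^ 54) / ε ^ 4) 6)
  refine ⟨max (max D₁ D₂) (max D₃ D₄), fun D _ χ hD hq hp hA a₁ a₂ ha₁ ha₂ s hs => ?_⟩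
  have hD1 : D₁ ≤ D := le_trans (le_trans (le_max_left _ _) (le_max_left _ _)) hD
  have hD2 : D₂ ≤ D := le_trans (le_trans (le_max_right _ _) (le_max_left _ _)) hD
  have hD3 : D₃ ≤ D := le_trans (le_trans (le_max_left _ _) (le_max_right _ _)) hD
  have hD4 : D₄ ≤ D := le_trans (le_trans (le_max_right _ _) (le_max_right _ _)) hD
  have hLmax := hD₄ D hD4
  have hL6 : 6 ≤ ell D := le_trans (le_max_right _ _) hLmax
  have hL1 : 1 ≤ ell D := by linarith
  have hX := (ha D χ a₁ a₂ s hs).trans (hD₁ D χ hD1 hq hp a₁ a₂ ha₁ ha₂ s hs)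
  exact le_eps_mul_of_bounds_scale e he hε (Real.exp_pos _)
    (Finset.sum_nonneg fun m _ => div_nonneg (sq_nonneg _) (Nat.cast_nonneg _))
    (Finset.sum_nonneg fun m _ => div_nonneg (sq_nonneg _) (Nat.cast_nonneg _))
    (Nat.cast_nonneg _) (majorantConst_pos _ _).le hX
    (sum_tau_sq_div_Ico_le 5 hL1) (sum_tau_sq_div_Ico_le 2 hL1) (hD₂ D χ hD2 hq hp hA)
    (hD₃ D hD3) hL6 (le_trans (le_max_left _ _) hLmax)

/-- **(7.5) under (A) at exponent `E ≥ 2001`** (`= 718 + 1283`): for every real `E ≥ 2001`, every `B` and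
`ε > 0`, for all large `D` and every real primitive `χ` mod `D` with `AssumptionAWith E D χ`, all `𝐚₁, 𝐚₂`
satisfying (7.2) with `B` and all `s` with `Re s = 1/2`,
`∑_{ψ∈Ψ₂} |∑_{m<P²}(κ∗a₁)(m)ψ(m)m^{−s}|·|A(𝐚₂;1−s,ψ̄)| ≤ ε𝔓` — `eq75_scale_of_prop21_rate` at `e = 718` over the
Part-I scale law `prop21_scale_of_assumptionAWith 718`. The printed (A) (`E = 2022`) gives the tree's
`Section7Eq75.eq75_holds` (not restated); the located budget's S0 infimum `2000` is the excluded boundary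
`e = 717`. [cite: Zhang2022LandauSiegel, §7 (7.5) p.35; §2 Prop. 2.1] -/
theorem eq75_scale_of_assumptionAWith (c' : ℝ) {E : ℝ} (hE : 2001 ≤ E) :
    ∀ B : ℝ, ∀ ε : ℝ, 0 < ε → ForAllLarge fun D _ χ => AssumptionAWith E D χ →
      ∀ a₁ a₂ : ℕ → ℂ, Adm72 D B a₁ → Adm72 D B a₂ →
        ∀ s : ℂ, s.re = 1 / 2 →
          ∑ x ∈ finsetOf (PsiTwo χ),
              ‖kconvHead c' x a₁ s‖ * ‖ApolyBar x a₂ (1 - s)‖ ≤ ε * frakP D :=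
  eq75_scale_of_prop21_rate c' 718 le_rfl
    (prop21_scale_of_assumptionAWith 718 (by norm_num) (by push_cast; linarith))

end Literature.NumberTheory.LFunctions.Zhang2022.Repair.Gap

end
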